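import Literature.Computability.QuantumComplexity.NonlocalGameClassicalValue
import HarnessLib

/-!
# The three-player GHZ game has classical value `3/4`

Topic `Literature/Computability/QuantumComplexity`, next to `NonlocalGameClassicalValue.lean`
(TWO-player games: `NonlocalGame`, `classicalValue`, `chsh = 3/4`), `MagicSquareGame.lean`,
`OddCycleGame.lean`, and `ShallowCircuitsGame.lean` (the cycle-GHZ game of Bravyi–Gosset–König in
combinatorial form).  Source (held text `paper:arxiv-2008.05059`, read at the cited place):

* J. Holmgren, R. Raz, *A Parallel Repetition Theorem for the GHZ Game*, APPROX/RANDOM 2021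
  (LIPIcs 207) 62 = arXiv:2008.05059 [HolmgrenRaz2020], §1.1 (The GHZ Game): “The GHZ game,
  which we will denote by 𝒢_GHZ, is a three-player game with query distribution Q_GHZ that is
  uniform on {x ∈ 𝔽₂³ : x₁ + x₂ + x₃ = 0}. To win, players are required on input (x₁, x₂, x₃) to
  produce (y₁, y₂, y₃) such that y₁ ⊕ y₂ ⊕ y₃ = x₁ ∨ x₂ ∨ x₃. It is easily verified that the
  value of 𝒢_GHZ is 3/4.”  (The perfect quantum strategy is Mermin's: B. Bertlmann, N. Friis,
  *Modern Quantum Theory* [BertlmannFriis2023] §18.2, eq. (18.15) — see `GHZMermin.lean`.)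

HONEST FRAMING (pub-qadeq lane — the GHZ ∕ parity game is the primitive of the shallow-circuit
separations quoted in A-rows (Bravyi–Gosset–König; Watts–Kothari–Schaeffer–Tal's parity halving
game “coincides with the GHZ game for n = 3”; Watts–Parham) and of three-party nonlocality
demonstrations): instance-level adjudication of specific advantage claims; no claim about BQP vs
BPP or the summit.  This file certifies the CLASSICAL value only (a maximum over the `4³ = 64`
deterministic strategies, not exceeded by shared randomness); the quantum strategy of value `1`
is recorded only as Boolean bookkeeping (`parity_eq_decide_prod_neg`) pointing to the GHZ
eigenvalue equations of `GHZMermin.lean`; no measurement model, no device.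

## Contents (all proved, 0 named facts)

* `GHZGame.Triple = Bool × Bool × Bool`, `parity`, `valid` (even parity: `000, 011, 101, 110`,
  `card_valid = 4`), `win` (`y₁ ⊕ y₂ ⊕ y₃ = x₁ ∨ x₂ ∨ x₃`), `wins f g h` (valid queries won by the
  deterministic strategy `xᵢ ↦ fᵢ(xᵢ)`), `detValue = wins/4`, `value` (max over deterministic
  strategies).
* **`wins_le_three`** (no deterministic strategy wins all four — `decide` over the `2⁶` value
  tables), `wins_const` (everybody answers `1`: exactly `3`), `detValue_le`, `detValue_const`,
  **`value_eq : value = 3/4`**, **`mixedValue_le`** (shared randomness: `≤ 3/4`).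
* `parity_eq_decide_prod_neg`: answer parity `=` `[product of the ±1 outcomes = −1]`.

## Mathlib / tree search

Mathlib: no nonlocal games.  Tree: the two-player framework `NonlocalGame S T A B` does not host a
three-player game, so the (tiny) three-player bookkeeping is done directly here in the same style
(`detValue`, `value` as a `Finset.sup'`, `mixedValue_le`); `ShallowCircuitsGame.lean`'s
`game_unwinnable` is the cycle-graph-state relative of `wins_le_three`, not the same statement.
-/

namespace Literature.Computability.QuantumComplexity

open Finset

namespace GHZGame

/-- A query / answer triple `(x₁, x₂, x₃) ∈ {0,1}³`. [cite: HolmgrenRaz2020, §1.1] -/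
abbrev Triple : Type := Bool × Bool × Bool

/-- The parity `x₁ ⊕ x₂ ⊕ x₃` of a triple. [cite: HolmgrenRaz2020, §1.1] -/
def parity (x : Triple) : Bool := xor (xor x.1 x.2.1) x.2.2

/-- The query distribution `Q_GHZ` is uniform on the EVEN-parity triples `{x ∈ 𝔽₂³ : x₁ + x₂ + x₃ = 0}`
(`000, 011, 101, 110`). [cite: HolmgrenRaz2020, §1.1] -/
def valid (x : Triple) : Bool := !parity x

/-- The winning condition `y₁ ⊕ y₂ ⊕ y₃ = x₁ ∨ x₂ ∨ x₃`. [cite: HolmgrenRaz2020, §1.1] -/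
def win (x y : Triple) : Bool := parity y == (x.1 || x.2.1 || x.2.2)

/-- The number of valid queries (out of `4`) won by the DETERMINISTIC strategy in which player `i`
answers `fᵢ(xᵢ)` (each player sees only its own bit). [cite: HolmgrenRaz2020, §1.1] -/
def wins (f g h : Bool → Bool) : ℕ :=
  (univ.filter fun x : Triple => valid x = true ∧ win x (f x.1, g x.2.1, h x.2.2) = true).card

/-- The winning probability of a deterministic strategy under `Q_GHZ`: `wins / 4`.
[cite: HolmgrenRaz2020, §1.1] -/
noncomputable def detValue (f g h : Bool → Bool) : ℝ := (wins f g h : ℝ) / 4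

/-- **The (classical) value** of the GHZ game: the maximum winning probability over deterministic
strategies (shared randomness cannot exceed it, `mixedValue_le_value`). [cite: HolmgrenRaz2020,
§1.1 (“the value of 𝒢_GHZ is 3/4”)] -/
noncomputable def value : ℝ :=
  (univ : Finset ((Bool → Bool) × (Bool → Bool) × (Bool → Bool))).sup' univ_nonempty
    fun fgh => detValue fgh.1 fgh.2.1 fgh.2.2

/-- There are four valid queries. [cite: HolmgrenRaz2020, §1.1] -/
theorem card_valid : (univ.filter fun x : Triple => valid x = true).card = 4 := by decide

/-- **No deterministic strategy wins all four valid queries; each wins at most `3`.**  (Summing the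
four winning conditions over `000, 011, 101, 110`: each player's two answers each appear twice on
the left, so the left side is `0`, while the right side is `0 ⊕ 1 ⊕ 1 ⊕ 1 = 1`.)
[cite: HolmgrenRaz2020, §1.1] -/
theorem wins_le_three (f g h : Bool → Bool) : wins f g h ≤ 3 := by
  -- a strategy `Bool → Bool` is its pair of values
  have hf : f = fun s => cond s (f true) (f false) := by funext s; cases s <;> rfl
  have hg : g = fun s => cond s (g true) (g false) := by funext s; cases s <;> rfl
  have hh : h = fun s => cond s (h true) (h false) := by funext s; cases s <;> rfl
  rw [hf, hg, hh]
  generalize f true = f₁; generalize f false = f₀; generalize g true = g₁; generalize g false = g₀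
  generalize h true = h₁; generalize h false = h₀
  revert f₀ f₁ g₀ g₁ h₀ h₁
  decide

/-- The constant strategy “everybody answers `1`” wins exactly the three queries `011, 101, 110`.
[cite: HolmgrenRaz2020, §1.1] -/
theorem wins_const : wins (fun _ => true) (fun _ => true) (fun _ => true) = 3 := by decide

/-- Every deterministic strategy has winning probability `≤ 3/4`. [cite: HolmgrenRaz2020, §1.1] -/
theorem detValue_le (f g h : Bool → Bool) : detValue f g h ≤ 3 / 4 := by
  have : (wins f g h : ℝ) ≤ 3 := by exact_mod_cast wins_le_three f g h
  unfold detValue; linarith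

/-- … and `3/4` is attained. [cite: HolmgrenRaz2020, §1.1] -/
theorem detValue_const : detValue (fun _ => true) (fun _ => true) (fun _ => true) = 3 / 4 := by
  unfold detValue; rw [wins_const]; norm_num

/-- Every deterministic strategy is bounded by the value. [cite: HolmgrenRaz2020, §1.1] -/
theorem detValue_le_value (f g h : Bool → Bool) : detValue f g h ≤ value :=
  le_sup' (f := fun fgh : (Bool → Bool) × (Bool → Bool) × (Bool → Bool) =>
    detValue fgh.1 fgh.2.1 fgh.2.2) (mem_univ (f, g, h))

/-- **The value of the GHZ game is `3/4`.** [cite: HolmgrenRaz2020, §1.1 (“It is easily verified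
that the value of 𝒢_GHZ is 3/4”)] -/
theorem value_eq : value = 3 / 4 :=
  le_antisymm (sup'_le _ _ fun _ _ => detValue_le _ _ _) (detValue_const ▸ detValue_le_value _ _ _)

/-- **Shared randomness cannot help**: a convex combination of deterministic strategies (the
players' common random string `i`) wins with probability at most `3/4`. [cite: HolmgrenRaz2020,
§1.1; CleveEtAl2004, §2 (“any probabilistic strategy can be expressed as a convex combination of
deterministic strategies”)] -/
theorem mixedValue_le {ι : Type*} (I : Finset ι) (w : ι → ℝ) (hw0 : ∀ i ∈ I, 0 ≤ w i)
    (hw1 : ∑ i ∈ I, w i = 1) (f g h : ι → Bool → Bool) :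
    ∑ i ∈ I, w i * detValue (f i) (g i) (h i) ≤ 3 / 4 := by
  calc ∑ i ∈ I, w i * detValue (f i) (g i) (h i)
      ≤ ∑ i ∈ I, w i * (3 / 4) :=
        sum_le_sum fun i hi => mul_le_mul_of_nonneg_left (detValue_le _ _ _) (hw0 i hi)
    _ = 3 / 4 := by rw [← sum_mul, hw1, one_mul]

/-- The rule of the perfect QUANTUM strategy read against the GHZ correlations: on input bit `0`
measure `σ_x`, on `1` measure `σ_y`; on the valid queries the measured product observable is
`X₁X₂X₃` (query `000`) or has exactly two `Y`'s (`011, 101, 110`), and a `±1`-outcome triple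
with product `+1` (resp. `−1`) has answer parity `0` (resp. `1`) — so eigenvalue `+1` on `XXX` and
`−1` on `XYY, YXY, YYX` (the state `(|000⟩ + |111⟩)/√2`; for `|GHZ⁻⟩` of `GHZMermin.lean` the signs
are opposite and one player flips her answer) wins every valid query.  Here only the Boolean
bookkeeping: the answer parity of outcomes `(m₁, m₂, m₃) ∈ {±1}³`, encoded `mᵢ = (−1)^{yᵢ}`, is
`[m₁m₂m₃ = −1]`. [cite: HolmgrenRaz2020, §1.1; BertlmannFriis2023, §18.2 eq. (18.15)] -/
theorem parity_eq_decide_prod_neg (y : Triple) :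
    parity y = decide (((if y.1 then (-1 : ℤ) else 1) * (if y.2.1 then -1 else 1) *
      (if y.2.2 then -1 else 1)) = -1) := by
  obtain ⟨a, b, c⟩ := y
  cases a <;> cases b <;> cases c <;> decide

end GHZGame

end Literature.Computability.QuantumComplexity
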